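import Summits.QuantumFields.YangMills.Theorems.AlphaInputsT3ACv3Step
import HarnessLib

/-!
# `AlphaInputsT3ACv3Induction` — (41) WITH THE WINDOWED PINNED WEIGHTS, `dV`-a.e., FOR THE LANE'S AC TOWER: `PinnedStep.ineq41_pinned_windowed_ae` WITH THE EXPONENT
# STEP UNBUNDLED (hypothesis `hexpo` instead of the nine-leaf `Thm2AC.StepResidualsAC`), so that the v3 (α) package (`AlphaInputsT3ACv3Lane`: eight mass-free leaves,
# no C1) feeds it — lane `pub-balaban3d`, seat alpha-1 (g3), owner ruling g18-№3 §3

One theorem, `PinnedStep.ineq41_pinned_windowed_ae_of_expo`; the proof is the landed one verbatim with `hexpo j hj` for the bookkeeping line.  Nothing of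
[Balaban1985UV3] is asserted: the (β) rows `Fibre55WinAC` and the exponent step are hypotheses here; the v3 socket discharges the latter from its rows.

References: T. Bałaban, Commun. Math. Phys. 102 (1985) 255–275 [Balaban1985UV3] ((41) p.266, (48)–(49) pp.267–268, (55) p.269, (58)–(62) pp.270–271).
-/

set_option autoImplicit false

noncomputable section

namespace Summit.QuantumFields.YangMills.Theorems.PinnedStep

open MeasureTheory
open Literature.MathematicalPhysics.QuantumFieldTheory.Balaban1983to89
open Literature.MathematicalPhysics.QuantumFieldTheory.Balaban1983to89.AveragingRT (rnTransport rnTransport_nonneg)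
open Literature.MathematicalPhysics.QuantumFieldTheory.Balaban1983to89.B10 (Ineq41)
open Literature.MathematicalPhysics.QuantumFieldTheory.Balaban1985CMP102
open Literature.MathematicalPhysics.QuantumFieldTheory.Balaban1985CMP102.Setting
open Summit.QuantumFields.Balaban3D.Carriers
open Summit.QuantumFields.Balaban3D.Proofs.Inputs (LaneConsts)
open Summit.QuantumFields.Balaban3D.Proofs.ScalesArithmetic (gk_pos gk_le_one)
open Summit.QuantumFields.Balaban3D.Proofs.TowerAC
open Summit.QuantumFields.Balaban3D.Proofs.StandardAC
open Summit.QuantumFields.Balaban3D.Proofs.InputsAC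
open Summit.QuantumFields.Balaban3D.Proofs.Bound55Masses (chiB chiB_nonneg chiB_le_one measurable_chiB measurable_stepWeight)
open Summit.QuantumFields.Balaban3D.Proofs.MassesPAC
open Summit.QuantumFields.Balaban3D.Proofs.TransportAC (integrable_mul_exp_of_le)
open Summit.QuantumFields.Balaban3D.Proofs.TransportDirectAC (transport41_le_sum_ae_direct)
open Summit.QuantumFields.Balaban3D.Proofs.Transport48 (integrable_weight_mul rnTransport_mono_ae)
open Summit.QuantumFields.Balaban3D.Proofs (Bound55Std.measurable_actionEta Bound55Std.actionEta_nonneg)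

variable {L : ℕ} (𝔎 : LaneConsts L) {S : Scales L} {G : Type} [GaugeGroup G] [MeasurableSpace G] [HaarData G]
  {E : Type} [NormedAddCommGroup E] [NormedSpace ℂ E]
  (X : ExternalInputsAC S G) (𝔖 : ∀ k, StepSeries S G E (nblkOf S 𝔎.carrier k) k)
  (win : (k : ℕ) → Hist S.P (k + 1) → Set (GaugeField S.P (k + 1) G)) [RegularGaugeGroup G]

/-! ## The induction with the exponent step as a hypothesis -/

/-- **(41) WITH PRINT'S WINDOWED PINNED WEIGHTS, `dV`-A.E., AT EVERY LEVEL `j ≤ K` — THE INDUCTION WITH THE EXPONENT STEP AS A HYPOTHESIS**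
(`ineq41_pinned_windowed_ae` with its use of the nine-leaf bundle `Thm2AC.StepResidualsAC` — through `RepAtHeightsAdapter.expo5558_le_expo41_succ` — replaced by the
per-history exponent inequality `hexpo` «(55)·(58) exponent at h′ ≤ (41)_{k+1} exponent at h′» itself, so that the v3 package, which has the eight mass-free leaves
only (`AlphaV3AC.expo5558_le_expo41_succ_of_alphaV3`), can feed it): if the rows `Fibre55WinAC` hold at every step `k < K` for every new history, `hexpo` holds, and
the data rows `hU`/`hPm`/`hPb` hold at every `k < K`, then for every `j ≤ K`, `ρ_j(V) ≤ Σ_h wtP_j(h, V)·exp(−mainT_j(h,V) + Pint_j(h,V) − E_j + Zterm_j(h) + Rm_j)`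
for `dV`-a.e. `V`.  Same proof: (41)₀ = (1)₀; transport `min(ρ_j, majorant_j)` by the DIRECT (48)–(49) step (`TransportDirectAC.transport41_le_sum_ae_direct`), fibre
hypothesis = the row VERBATIM (print's `χ_k(proj h′)` on the left, R-g18-a), version honesty `Carriers.run3_rho_succ_ae_eq_rn`.
[cite: Balaban1985UV3, (41) p.266 + (48)–(49) pp.267–268 + (55) p.269] -/
theorem ineq41_pinned_windowed_ae_of_expo (hwin : ∀ k h', MeasurableSet (win k h'))
    (hrow : ∀ k, k + 1 ≤ S.K → ∀ h' : Hist S.P (k + 1), Fibre55WinAC 𝔎 X 𝔖 win k h')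
    (hexpo : ∀ k, k + 1 ≤ S.K → ∀ (hh : Hist S.P (k + 1)) (U : GaugeField S.P (k + 1) G),
      -((towerOfAC 𝔎 X 𝔖).mainT (k + 1) hh U) - (towerOfAC 𝔎 X 𝔖).Ecst k
          + ((piecesAC 𝔎 X 𝔖 k).logσ₀ + (piecesAC 𝔎 X 𝔖 k).dg * Real.log ((towerOfAC 𝔎 X 𝔖).g k)) * (piecesAC 𝔎 X 𝔖 k).starB hh
          + (piecesAC 𝔎 X 𝔖 k).logZU hh U + (piecesAC 𝔎 X 𝔖 k).Pold hh U
          + (towerOfAC 𝔎 X 𝔖).Zterm k ((piecesAC 𝔎 X 𝔖 k).proj hh) + (towerOfAC 𝔎 X 𝔖).Rm k + (piecesAC 𝔎 X 𝔖 k).logFl hh U ≤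
        -((towerOfAC 𝔎 X 𝔖).mainT (k + 1) hh U) + (towerOfAC 𝔎 X 𝔖).Pint (k + 1) hh U - (towerOfAC 𝔎 X 𝔖).Ecst (k + 1)
          + (towerOfAC 𝔎 X 𝔖).Zterm (k + 1) hh + (towerOfAC 𝔎 X 𝔖).Rm (k + 1))
    (hU : ∀ k, k + 1 ≤ S.K → ∀ h : Hist S.P k, Measurable (X.UkH k h))
    (hPm : ∀ k, k + 1 ≤ S.K → ∀ h : Hist S.P k, Measurable ((inputOfAC 𝔎 X 𝔖).Pint k h))
    (hPb : ∀ k, k + 1 ≤ S.K → ∃ cP : ℝ, ∀ (h : Hist S.P k) (U : GaugeField S.P k G), (inputOfAC 𝔎 X 𝔖).Pint k h U ≤ cP) :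
    ∀ j : ℕ, j ≤ S.K → ∀ᵐ V ∂(fieldMeasure S.P j G), (towerOfAC 𝔎 X 𝔖).ρ j V ≤
      ∑ h : Hist S.P j, wtP 𝔎 X win j h V *
        Real.exp (-((towerOfAC 𝔎 X 𝔖).mainT j h V) + (towerOfAC 𝔎 X 𝔖).Pint j h V - (towerOfAC 𝔎 X 𝔖).Ecst j
          + (towerOfAC 𝔎 X 𝔖).Zterm j h + (towerOfAC 𝔎 X 𝔖).Rm j) := by
  classical
  intro j
  induction j with
  | zero =>
    intro _
    exact ae_of_all _ fun V => (Summit.QuantumFields.Balaban3D.Proofs.Thm2AC.step0_towerOfAC 𝔎 X 𝔖).1 V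
  | succ j ih =>
    intro hj
    have ihj := ih (by omega)
    obtain ⟨cP, hcP⟩ := hPb j hj
    have hLS := Summit.QuantumFields.Balaban3D.Proofs.AlphaBound55.eps1Of_le_epsSOf j 𝔎.carrier 𝔎.F.b₀_nonneg 𝔎.F.p₀_pos.le
      (show j ≤ S.K by omega)
    -- integrability of the level-`j` summands for the weights `wtP`
    have hintW : ∀ h : Hist S.P j, Integrable (fun U => wtP 𝔎 X win j h U * Real.exp (-((towerOfAC 𝔎 X 𝔖).mainT j h U) + (towerOfAC 𝔎 X 𝔖).Pint j h U - (towerOfAC 𝔎 X 𝔖).Ecst j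
            + (towerOfAC 𝔎 X 𝔖).Zterm j h + (towerOfAC 𝔎 X 𝔖).Rm j)) (fieldMeasure S.P j G) :=
      fun h => integrable_mul_exp41 𝔎 X 𝔖 j (hU j hj) (hPm j hj) cP hcP h (integrable_wtP_and_integral_le 𝔎 X win hwin j h).1
    have hMaj_int : Integrable (fun U => ∑ h : Hist S.P j, wtP 𝔎 X win j h U * Real.exp (-((towerOfAC 𝔎 X 𝔖).mainT j h U) + (towerOfAC 𝔎 X 𝔖).Pint j h U - (towerOfAC 𝔎 X 𝔖).Ecst j
            + (towerOfAC 𝔎 X 𝔖).Zterm j h + (towerOfAC 𝔎 X 𝔖).Rm j)) (fieldMeasure S.P j G) := integrable_finsetSum _ fun h _ => hintW h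
    have hMaj0 : ∀ U, 0 ≤ (fun U => ∑ h : Hist S.P j, wtP 𝔎 X win j h U * Real.exp (-((towerOfAC 𝔎 X 𝔖).mainT j h U) + (towerOfAC 𝔎 X 𝔖).Pint j h U - (towerOfAC 𝔎 X 𝔖).Ecst j
            + (towerOfAC 𝔎 X 𝔖).Zterm j h + (towerOfAC 𝔎 X 𝔖).Rm j)) U := fun U =>
      Finset.sum_nonneg fun h _ => mul_nonneg (wtP_nonneg_le 𝔎 X win j h U).1 (Real.exp_pos _).le
    -- the a.e.-modified density `min ρ_j Maj`
    have hpin : (towerOfAC 𝔎 X 𝔖).ρ j = (towerWAC 𝔎 X 𝔖).rho j := (towerWAC 𝔎 X 𝔖).pin_rho j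
    have hρ0 : ∀ U, 0 ≤ (towerOfAC 𝔎 X 𝔖).ρ j U := fun U => by
      rw [hpin]; exact run3_rho_nonneg ((inputOfAC 𝔎 X 𝔖).toRunInput fun _ => True) j U
    have hρi : Integrable ((towerOfAC 𝔎 X 𝔖).ρ j) (fieldMeasure S.P j G) := by
      rw [hpin]; exact run3_rho_integrable ((inputOfAC 𝔎 X 𝔖).toRunInput fun _ => True) j
    have hρt0 : ∀ U, 0 ≤ (fun U => min ((towerOfAC 𝔎 X 𝔖).ρ j U) ((fun U => ∑ h : Hist S.P j, wtP 𝔎 X win j h U * Real.exp (-((towerOfAC 𝔎 X 𝔖).mainT j h U) + (towerOfAC 𝔎 X 𝔖).Pint j h U - (towerOfAC 𝔎 X 𝔖).Ecst j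
            + (towerOfAC 𝔎 X 𝔖).Zterm j h + (towerOfAC 𝔎 X 𝔖).Rm j)) U)) U := fun U => le_min (hρ0 U) (hMaj0 U)
    have hρt_ae : (towerOfAC 𝔎 X 𝔖).ρ j =ᵐ[fieldMeasure S.P j G] (fun U => min ((towerOfAC 𝔎 X 𝔖).ρ j U) ((fun U => ∑ h : Hist S.P j, wtP 𝔎 X win j h U * Real.exp (-((towerOfAC 𝔎 X 𝔖).mainT j h U) + (towerOfAC 𝔎 X 𝔖).Pint j h U - (towerOfAC 𝔎 X 𝔖).Ecst j
            + (towerOfAC 𝔎 X 𝔖).Zterm j h + (towerOfAC 𝔎 X 𝔖).Rm j)) U)) := by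
      filter_upwards [ihj] with U hU
      exact (min_eq_left hU).symm
    have hρti : Integrable (fun U => min ((towerOfAC 𝔎 X 𝔖).ρ j U) ((fun U => ∑ h : Hist S.P j, wtP 𝔎 X win j h U * Real.exp (-((towerOfAC 𝔎 X 𝔖).mainT j h U) + (towerOfAC 𝔎 X 𝔖).Pint j h U - (towerOfAC 𝔎 X 𝔖).Ecst j
            + (towerOfAC 𝔎 X 𝔖).Zterm j h + (towerOfAC 𝔎 X 𝔖).Rm j)) U)) (fieldMeasure S.P j G) := hρi.congr hρt_ae
    -- the DIRECT (48)–(49) step for the modified density: its fibre hypothesis IS the row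
    have hdirect : ∀ h' : Hist S.P (j + 1),
        (rnTransport (X.av j).avg (fun U =>
          stepWeight 𝔎.carrier.M₁ (rcolOf S 𝔎.carrier) (eps1Of S 𝔎.carrier) (epsSOf S 𝔎.carrier) j h' U *
            chiB 𝔎.carrier.M₁ (rcolOf S 𝔎.carrier) (eps1Of S 𝔎.carrier) j h' U *
            (wtP 𝔎 X win j h'.proj U * Real.exp (-((towerOfAC 𝔎 X 𝔖).mainT j h'.proj U) + (towerOfAC 𝔎 X 𝔖).Pint j h'.proj U - (towerOfAC 𝔎 X 𝔖).Ecst j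
            + (towerOfAC 𝔎 X 𝔖).Zterm j h'.proj + (towerOfAC 𝔎 X 𝔖).Rm j))))
        ≤ᵐ[fieldMeasure S.P (j + 1) G] fun V => massP 𝔎 X (j + 1) h' V *
          ((win j h').indicator (fun _ => (1 : ℝ)) V * Real.exp (-((towerOfAC 𝔎 X 𝔖).mainT (j + 1) h' V) - (towerOfAC 𝔎 X 𝔖).Ecst j
              + ((piecesAC 𝔎 X 𝔖 j).logσ₀ + (piecesAC 𝔎 X 𝔖 j).dg * Real.log ((towerOfAC 𝔎 X 𝔖).g j)) * (piecesAC 𝔎 X 𝔖 j).starB h'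
              + (piecesAC 𝔎 X 𝔖 j).logZU h' V + (piecesAC 𝔎 X 𝔖 j).Pold h' V
              + (towerOfAC 𝔎 X 𝔖).Zterm j ((piecesAC 𝔎 X 𝔖 j).proj h') + (towerOfAC 𝔎 X 𝔖).Rm j + (piecesAC 𝔎 X 𝔖 j).logFl h' V)) := by
      intro h'
      have h2 := hrow j hj h'
      unfold Fibre55WinAC at h2
      filter_upwards [h2] with V hV
      exact hV.trans (le_of_eq (by ring))
    have hstep := transport41_le_sum_ae_direct (X.av_ac j) (Hist.proj (P := S.P) (k := j)) (fun U => min ((towerOfAC 𝔎 X 𝔖).ρ j U) ((fun U => ∑ h : Hist S.P j, wtP 𝔎 X win j h U * Real.exp (-((towerOfAC 𝔎 X 𝔖).mainT j h U) + (towerOfAC 𝔎 X 𝔖).Pint j h U - (towerOfAC 𝔎 X 𝔖).Ecst j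
            + (towerOfAC 𝔎 X 𝔖).Zterm j h + (towerOfAC 𝔎 X 𝔖).Rm j)) U)) hρti
      (wtP 𝔎 X win j) (fun h U => (-((towerOfAC 𝔎 X 𝔖).mainT j h U) + (towerOfAC 𝔎 X 𝔖).Pint j h U - (towerOfAC 𝔎 X 𝔖).Ecst j
            + (towerOfAC 𝔎 X 𝔖).Zterm j h + (towerOfAC 𝔎 X 𝔖).Rm j))
      (stepWeight 𝔎.carrier.M₁ (rcolOf S 𝔎.carrier) (eps1Of S 𝔎.carrier) (epsSOf S 𝔎.carrier) j)
      (chiB 𝔎.carrier.M₁ (rcolOf S 𝔎.carrier) (eps1Of S 𝔎.carrier) j)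
      (massP 𝔎 X (j + 1))
      (fun h' V => (win j h').indicator (fun _ => (1 : ℝ)) V * Real.exp (-((towerOfAC 𝔎 X 𝔖).mainT (j + 1) h' V) - (towerOfAC 𝔎 X 𝔖).Ecst j
              + ((piecesAC 𝔎 X 𝔖 j).logσ₀ + (piecesAC 𝔎 X 𝔖 j).dg * Real.log ((towerOfAC 𝔎 X 𝔖).g j)) * (piecesAC 𝔎 X 𝔖 j).starB h'
              + (piecesAC 𝔎 X 𝔖 j).logZU h' V + (piecesAC 𝔎 X 𝔖 j).Pold h' V
              + (towerOfAC 𝔎 X 𝔖).Zterm j ((piecesAC 𝔎 X 𝔖 j).proj h') + (towerOfAC 𝔎 X 𝔖).Rm j + (piecesAC 𝔎 X 𝔖 j).logFl h' V))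
      (fun U => min_le_right _ _) hintW (fun h U => (wtP_nonneg_le 𝔎 X win j h U).1)
      (measurable_stepWeight _ _ _ _ j) (stepWeight_nonneg _ _ _ _ j) (stepWeight_le_one _ _ _ _ j)
      (measurable_chiB _ _ _ j) (chiB_nonneg _ _ _ j) (chiB_le_one _ _ _ j)
      (fun h U hne => massRecP_cover _ _ _ _ _ j hLS h U (fun h0 => hne (le_antisymm
        (h0 ▸ (wtP_nonneg_le 𝔎 X win j h U).2) (wtP_nonneg_le 𝔎 X win j h U).1)))
      hdirect
    -- the honesty of the version selection: `ρ_(j+1) = T_j ρ_j = T_j (min ρ_j Maj)` a.e.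
    have hρT : ∀ᵐ V ∂(fieldMeasure S.P (j + 1) G), (towerOfAC 𝔎 X 𝔖).ρ (j + 1) V = rnTransport (X.av j).avg (fun U => min ((towerOfAC 𝔎 X 𝔖).ρ j U) ((fun U => ∑ h : Hist S.P j, wtP 𝔎 X win j h U * Real.exp (-((towerOfAC 𝔎 X 𝔖).mainT j h U) + (towerOfAC 𝔎 X 𝔖).Pint j h U - (towerOfAC 𝔎 X 𝔖).Ecst j
            + (towerOfAC 𝔎 X 𝔖).Zterm j h + (towerOfAC 𝔎 X 𝔖).Rm j)) U)) V := by
      have hW : (towerWAC 𝔎 X 𝔖).rho j =ᵐ[fieldMeasure S.P j G] (fun U => min ((towerOfAC 𝔎 X 𝔖).ρ j U) ((fun U => ∑ h : Hist S.P j, wtP 𝔎 X win j h U * Real.exp (-((towerOfAC 𝔎 X 𝔖).mainT j h U) + (towerOfAC 𝔎 X 𝔖).Pint j h U - (towerOfAC 𝔎 X 𝔖).Ecst j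
            + (towerOfAC 𝔎 X 𝔖).Zterm j h + (towerOfAC 𝔎 X 𝔖).Rm j)) U)) := by
        rw [← hpin]
        exact hρt_ae
      have hcongr : rnTransport (X.av j).avg ((towerWAC 𝔎 X 𝔖).rho j) = rnTransport (X.av j).avg (fun U => min ((towerOfAC 𝔎 X 𝔖).ρ j U) ((fun U => ∑ h : Hist S.P j, wtP 𝔎 X win j h U * Real.exp (-((towerOfAC 𝔎 X 𝔖).mainT j h U) + (towerOfAC 𝔎 X 𝔖).Pint j h U - (towerOfAC 𝔎 X 𝔖).Ecst j
            + (towerOfAC 𝔎 X 𝔖).Zterm j h + (towerOfAC 𝔎 X 𝔖).Rm j)) U)) :=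
        rnTransport_congr_ae hW (fun U => run3_rho_nonneg ((inputOfAC 𝔎 X 𝔖).toRunInput fun _ => True) j U) hρt0
      filter_upwards [run3_rho_succ_ae_eq_rn ((inputOfAC 𝔎 X 𝔖).toRunInput fun _ => True) j] with V hV
      rw [← hcongr]
      exact (congrFun ((towerWAC 𝔎 X 𝔖).pin_rho (j + 1)) V).trans hV
    -- exponent bookkeeping
    have hexp := hexpo j hj
    filter_upwards [hstep, hρT] with V hV hρV
    rw [hρV]
    refine hV.trans (Finset.sum_le_sum fun h' _ => ?_)
    rw [wtP_succ]
    have hM0 := massRecP_nonneg 𝔎.carrier.M₁ (rcolOf S 𝔎.carrier) (eps1Of S 𝔎.carrier) (epsSOf S 𝔎.carrier) X.av (j + 1) h' V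
    have hi0 : 0 ≤ (win j h').indicator (fun _ => (1 : ℝ)) V := Set.indicator_nonneg (fun _ _ => zero_le_one) V
    have key : ∀ {m i x y : ℝ}, 0 ≤ m → 0 ≤ i → x ≤ y → m * (i * x) ≤ i * m * y := by
      intro m i x y hm hi hxy
      calc m * (i * x) = i * m * x := by ring
        _ ≤ i * m * y := mul_le_mul_of_nonneg_left hxy (mul_nonneg hi hm)
    exact key hM0 hi0 (Real.exp_le_exp.mpr (hexp h' V))

end Summit.QuantumFields.YangMills.Theorems.PinnedStep

end
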